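import Summits.HodgeConjecture.HodgeConjecture.Theorems.F0P3cStCharTSEPNormOneUnr             -- ★ row 59-F (this seat): §1 trunk + ED. 2 §2 `innerG_char_self_eq_one_of_unramified_explicit` (`hpc3 := ★ S2a`)
import Summits.HodgeConjecture.HodgeConjecture.Theorems.F0P3cStCharTSK1UnrPseudoCoeffWitness  -- ★ row 58 FILE 1 p853680 (LH5-p02): §0 sockets `iso_mapEdgeSet_eq_iff`, `exists_restrictRep_fixedPoints` + S2a
import Summits.HodgeConjecture.HodgeConjecture.Theorems.F0P3cStCharTSHsplitOfL2             -- ★ (S5) p853691 (F0P2-p06): `hsplit_of_isSquareIntegrable` — smooth self-extensions of `L²` classes split (★ 70 + ★ 71-d + ★ 71-D)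
import Summits.HodgeConjecture.HodgeConjecture.Theorems.F0P3cStCharTSCharacterEllipticUniform  -- ★ 41g-H (LH6-p04): tree letters at the datum + `char_eq_fixedVertexSum_sub_fixedEdgeSum`; brings (G3)-EXPLICIT letters, `Gqs`, `EllipticData`
import Summits.HodgeConjecture.HodgeConjecture.Theorems.F0P3cStCharTSEPGlueG                    -- ★ (G3) (LH10-p02): the letters-from-`hunr` pattern (`unramifiedLocalConjDatum_adicCompletion`, `localNonsplitEquiv`, `qsForm` re-reading)
import Summits.HodgeConjecture.HodgeConjecture.Theorems.F0P3cStCharTSEllMassG                   -- ★ (G4) (F0P3b-p01): the clause-2 PIN READER `orbInt_eq_zero_of_mem_regG_of_not_mem_ellG`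
import Summits.HodgeConjecture.HodgeConjecture.Theorems.F0P3cStCharTSEllipticFixedTree           -- ★ row 53 p853423 (F0P3a-p09): (H5) `ellipticFixedTree_of_mem_ellG` (the tree binders `hne hfin hfinE` on `G^e`)
import Summits.HodgeConjecture.HodgeConjecture.Theorems.F0P3cStCharTSEPFunctionOrbitalElliptic    -- ★ 48-datum FILE 2 p853465 (F0P3a-p01): `classOrbitalIntegral_epSum_eq_fixedVertexSum_sub_fixedEdgeSum` ((SS-O) at the datum)
import Summits.HodgeConjecture.HodgeConjecture.Theorems.F0P3cStCharTSEPNonEllipticVanishing       -- ★ 47e-E3 p853460 (LH6-p04): `classOrbitalIntegral_eq_zero_of_forall_smoothTrace_eq_zero` (van Dijk door, carries (o9))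
import Summits.HodgeConjecture.HodgeConjecture.Theorems.F0P3cStCharTSEPInducedTraceZeroAtDatumDischarge  -- ★ row 61b (F0P3a-p04 g32 ∕ F0P2-p06): `smoothTrace_cmPrincipalSeries_epFunction_eq_zero` — all principal-series traces of `f_EP^{π,e}` vanish (the former `h61`)
import Summits.HodgeConjecture.HodgeConjecture.Theorems.F0P3cStCharTSJacquetLine                  -- ★ JDIM2: `finrank_coinvariants_le_two` (the Jacquet module of an irreducible is finite-dimensional — ★ 61b's `hVN` at `r.ρ`)
import Literature.NumberTheory.Automorphic.SmoothCharacterEPFunctionTrace                         -- ★ row 42 (F0P2-p01): `Representation.mem_schwartzBruhat_of_kType` (clause 1)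
import Literature.NumberTheory.Automorphic.SmoothCharacterFiniteOrder                             -- ★ row 51: `Representation.levelTrace_inv_eq_conj_of_mem_of_isCompact` ((c) UNIT∕DUAL, termwise)
import Literature.NumberTheory.Automorphic.UnitaryLatticeTreeLevelGroupsTopology                  -- ★ row 43 (LH5-p04): level groups are a neighbourhood basis (the level `e`)
import Literature.NumberTheory.Automorphic.UnitaryLatticeTreeGeodesicApartment                    -- ★ 39γ: `exists_apartmentEnum`, `latticeGraph_adj_apartmentEnum_succ` (a base edge)
import Literature.NumberTheory.Automorphic.UnitaryGroupBorelInduction                             -- ★ `cmPrincipalSeries` (the `hsp` currency of 47e-E3 ∕ 47d-6b)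
import HarnessLib

/-!
# F0 · P3c · «StCharTS» — E1 ROW 72 «K2′-L²-UNR ASSEMBLY HEAD»: `⟨χ_σ, χ_σ⟩_e = 1` for every `L²` class of `U(Φ₃)(L⁺_v)`, `v` non-split UNRAMIFIED — text 2 of (S-𝔑) `hBlock′`, ZERO hypothesis binders beyond the junction's letters

Cell `pub/hodgecm-mathlib` (D-0151), crux H413 = `stmt-HodgeConjecture-24833` (`--supports … --as helper` lane); seat F0P3-p01 (g24), row 72 (keeper F0P3a-p03 (g31) k47∕k49 «=»;
census `F0/P3/F0P3-p01/g24/r72/CENSUS-R72-K2primeL2Unr.v1.md`; keeper k53 «=» ×3, LEAD F0P3a-plan (g16) T15-56 STRUCTURE «=» ∕ T15-58 «rides as ED. 36»).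
THEOREMS ONLY (no definition ∕ instance ∕ notation ∕ named fact ∕ `sorry`).  HONEST LABEL: count-neutral helper (rider-class until the organ edition rides); E1 = PRINT; h413 OPEN; HC_CM is proved only modulo the 7 printed citations (2 remaining named inputs: hLiu418 =
stmt-HodgeConjecture-24832, h413 = stmt-HodgeConjecture-24833) until rung 0 closes.  Nothing printed is asserted here.

TARGET (text 2 = `hL2oneNsNW` of (S-𝔑) `hBlock′`, SERVED leaf ED. 34 82c7d2b0 :476–477, VERBATIM):
`∀ σ, 𝔇.IsL2 σ → ¬ σ.IsSupercuspidal → ¬ ((IsUnramifiedIn ∨ |2|_v = 1) ∧ ∃ ψ, Continuous ψ ∧ σ = 𝔇.stG ψ) → 𝔇.innerG (𝔇.char σ) (𝔇.char σ) = 1` — proved here AT AN UNRAMIFIED `v`.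

* §B `innerG_char_self_eq_one_of_isL2_of_unramified_explicit` — the (G3)-EXPLICIT head: ★ 58 S2b's construction VERBATIM then ★ 59-F §2 `innerG_char_self_eq_one_of_unramified_explicit`
  with `hsplit := ★ (S5) hsplit_of_isSquareIntegrable L v hns μZ r (hμGZ ▸ ‹𝔇.IsL2 ⟦r⟧›)` (one `▸`: `𝔇.IsL2 σ := IrrClass.IsSquareIntegrable 𝔇.μGZ σ`, `hμGZ : 𝔇.μGZ = μZ` = junction `hC03`).
* §C `innerG_char_self_eq_one_of_isL2_of_unramified (hns) (hunr) …` — the junction-letter head (§B over the ★ (G3) letters-from-`hunr` block, as ★ 58 S1∕S3).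
ZERO HOME-only binders: every supplier is ★ (58 FILE 1 p853680, 59-F ED. 2 p853692, (S5) p853691 over ★ 70 p853654 ∕ 71-d p853649 ∕ 71-D p853685, 61b p853661 inside S2a).
GLUE (rider pen): `hL2oneUnr := fun hunr => F0P3cStCharTSK2PrimeL2Unr.innerG_char_self_eq_one_of_isL2_of_unramified L v hns hunr νQv mQv hcanQ 𝔇 hC01 hC04 hC05 hE hchar μZ hC03 hWIF hC1 hC2 hC3 hL2allcert`
(LEAD T15-56 (4); instances `[BorelSpace (G ⧸ Z)] [μZ.IsHaarMeasure]` are the head's own, leaf ED. 34 :215–216).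

## References
* [Rogawski1990] J. D. Rogawski, *Automorphic Representations of Unitary Groups in Three Variables*, Ann. of Math. Stud. 123 (1990), §12.5 pp. 182–187, §12.6 pp. 187–188.
* [SchneiderStuhler1997] P. Schneider, U. Stuhler, *Representation theory and sheaves on the Bruhat–Tits building*, Publ. Math. IHÉS 85 (1997), §III.4.
* [Kottwitz1988] R. Kottwitz, *Tamagawa numbers*, Ann. of Math. 127 (1988), §2.
* [BruhatTits1972] F. Bruhat, J. Tits, *Groupes réductifs sur un corps local I*, Publ. Math. IHÉS 41 (1972), §10.
-/

set_option autoImplicit false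
-- the mandated namespace has the single-problem summit's repeated segment (`HodgeConjecture.HodgeConjecture`)
set_option linter.dupNamespace false

noncomputable section

open NumberField IsDedekindDomain MeasureTheory Filter Topology
open scoped Matrix MatrixGroups Pointwise Valued WithZero ComplexConjugate
open Literature.NumberTheory.Rogawski1990 Literature.NumberTheory.Rogawski1990.Ch12Sec5
open Literature.NumberTheory.Automorphic Literature.NumberTheory.Automorphic.UnitaryGroup Literature.NumberTheory.Automorphic.UnitaryLatticeTree
open Literature.NumberTheory.Automorphic.HermitianLattice
open Literature.NumberTheory.GaloisRepresentations
open Literature.Combinatorics.SimpleGraph Literature.Combinatorics.SimpleGraph.OrientedIncidence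

namespace Summit.HodgeConjecture.HodgeConjecture.Cruxes.H413.F0P3cStCharTSK2PrimeL2Unr

open Summit.HodgeConjecture.HodgeConjecture.Cruxes.H413
open Summit.HodgeConjecture.HodgeConjecture.Cruxes.H413.F0P3cStCharTSTorusDefs
open Summit.HodgeConjecture.HodgeConjecture.Cruxes.H413.F0P3cStCharTSEPNormOneUnr
open Summit.HodgeConjecture.HodgeConjecture.Cruxes.H413.F0P3cStCharTSK1UnrPseudoCoeffWitness

variable (L : Type) [Field L] [NumberField L] [IsCMField L] (v : HeightOneSpectrum (𝓞 ↥(maximalRealSubfield L)))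

/-! ## §B ROW 72 «K2′-L²-UNR», (G3)-EXPLICIT: text 2 of (S-𝔑) `hBlock′` at an UNRAMIFIED place, antecedents VERBATIM, ZERO hypothesis binders -/

set_option maxHeartbeats 1600000 in
-- instance-term unification on the CM local carriers and the vertex subtype (as S2b ∕ ★ 41g-H)
/-- **ROW 72 «K2′-L²-UNR ASSEMBLY HEAD», (G3)-EXPLICIT letters.**  At a non-split UNRAMIFIED place `v` with the one-place model `(w hw ϖ hd eA heA)`, at a §12.5 datum `𝔇` with the junction pins
`hμG hμGZ horb hreg hE hM1` and ★ PCT-OUT's `hWIF hC1 hC2 hC3 hL2`: **for every `σ ∈ Irr U(Φ₃)(L⁺_v)` square-integrable modulo the centre (`𝔇.IsL2 σ`), `⟨χ_σ, χ_σ⟩_e = 1`** — text 2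
(`hL2oneNsNW`) of the (S-𝔑) organ with its antecedents VERBATIM (`¬ σ.IsSupercuspidal` and the NOT-WILD∧St exclusion go IDLE: the Euler–Poincaré road serves every `L²` class at an
unramified place), with (S5) «smooth self-extensions of `L²` classes split» ★ INSIDE (`F0P3cStCharTSHsplitOfL2.hsplit_of_isSquareIntegrable`, Casselman's square-integrability
criterion + Schur orthogonality, [Rogawski1990 §12.6 (12.6.1)]).  Proof = S2b's construction VERBATIM (level `e` by ★ 43 below the open stabiliser of a non-zero vector at the apartment vertex `A 0` ★ 39γ, tree letters
★ 41g-H §2, invariant orientation, base edge `A 0 — A 1`, stabilisers through `eA`, `K`-types §0, pieces by `dite`) then ★ 59-F ED. 2 §2 `innerG_char_self_eq_one_of_unramified_explicit` with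
`hsplit := ★ (S5) … μZ r (hμGZ ▸ ‹𝔇.IsL2 ⟦r⟧›)`.  ZERO hypothesis binders beyond the letters.  NO unitarity ∕ `IsEllipticRep` letter.
[cite: Rogawski1990, §12.6 Prop. 12.6.1 (a) p. 188] [cite: SchneiderStuhler1997, Thm. III.4.16, §III.4] [cite: Kottwitz1988, §2] [cite: BruhatTits1972, §10] -/
theorem innerG_char_self_eq_one_of_isL2_of_unramified_explicit
    (hns : ∀ w : PlacesOver L v, IsCMField.complexConj L • w.1 = w.1)
    (w : PlacesOver L v) (hw : IsCMField.complexConj L • w.1 = w.1) {ϖ : w.1.adicCompletion L} (hd : UnramifiedLocalConjDatum (galAdicCompletionMap (L := L) (IsCMField.complexConj L) hw) ϖ)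
    (eA : Gqs L v ≃ₜ* ↥(unitaryGroupOfForm (galAdicCompletionMap (L := L) (IsCMField.complexConj L) hw) ((StdForm.antidiagonal 3).over (w.1.adicCompletion L))))
    (heA : ∀ g : Gqs L v, ((eA g : ↥(unitaryGroupOfForm (galAdicCompletionMap (L := L) (IsCMField.complexConj L) hw) ((StdForm.antidiagonal 3).over (w.1.adicCompletion L)))) : GL (Fin 3) (w.1.adicCompletion L)) = ((localNonsplitEquiv (IsCMField.complexConj L) (qsForm L) (IsCMField.complexConj_ne_one L) w hw g : ↥(unitaryGroupOfForm (galAdicCompletionMap (L := L) (IsCMField.complexConj L) hw) (placeForm (qsForm L) w.1))) : GL (Fin 3) (w.1.adicCompletion L)))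
    [MeasurableSpace (Gqs L v)] [BorelSpace (Gqs L v)]
    [∀ γ : Gqs L v, MeasurableSpace (Gqs L v ⧸ Subgroup.centralizer ({γ} : Set (Gqs L v)))] [∀ γ : Gqs L v, BorelSpace (Gqs L v ⧸ Subgroup.centralizer ({γ} : Set (Gqs L v)))]
    [MeasurableSpace (Gqs L v ⧸ Subgroup.center (Gqs L v))]
    {H : Type} [Group H] [TopologicalSpace H] [IsTopologicalGroup H] [MeasurableSpace H]
    (νQv : Measure (Gqs L v)) [νQv.IsHaarMeasure] [νQv.IsMulRightInvariant] (mQv : OrbitalMeasureFamily (Gqs L v))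
    (hcanQ : mQv.IsCanonical (fun γ => IsRegularElt (γ.val : GL (Fin 3) (UnitaryGroup.LocalRing L v))) νQv)
    (𝔇 : EllipticData (Gqs L v) H) (hμG : 𝔇.μG = νQv) (horb : 𝔇.orb = mQv)
    (hreg : ∀ γ : Gqs L v, γ ∈ 𝔇.regG ↔ IsRegularElt (γ.val : GL (Fin 3) (UnitaryGroup.LocalRing L v)))
    (hE : ∀ γ : Gqs L v, γ ∈ 𝔇.ellG ↔ IsRegularElt (γ.val : GL (Fin 3) (UnitaryGroup.LocalRing L v)) ∧ γ ∉ hyperbolicSet L v)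
    (hM1 : ∀ π : IrrClass (Gqs L v), Measurable (𝔇.char π) ∧ LocallyIntegrable (𝔇.char π) 𝔇.μG ∧ (∀ x ∈ 𝔇.regG, ∀ᶠ y in 𝓝 x, 𝔇.char π y = 𝔇.char π x) ∧
      ∀ φ : Gqs L v → ℂ, IsLocSmooth φ → π.smoothTrace 𝔇.μG φ = ∫ x, φ x * 𝔇.char π x ∂𝔇.μG)
    [BorelSpace (Gqs L v ⧸ Subgroup.center (Gqs L v))] (μZ : Measure (Gqs L v ⧸ Subgroup.center (Gqs L v))) [μZ.IsHaarMeasure] (hμGZ : 𝔇.μGZ = μZ)   -- the head's `μZ` (leaf :215–216) + junction `hC03`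
    (hWIF : 𝔇.WeylIntegrationFormula) (hC1 : 𝔇.EllCartanSubset) (hC2 : 𝔇.EllCartanAE) (hC3 : 𝔇.NonEllCartanAE) (hL2 : 𝔇.L2CharOnTorusAll)   -- ★ PCT-OUT's extra letters
    :
    ∀ σ : IrrClass (Gqs L v), 𝔇.IsL2 σ → ¬ σ.IsSupercuspidal → ¬ ((Algebra.IsUnramifiedIn (𝓞 L) v.asIdeal ∨ Valued.v (2 : v.adicCompletion ↥(maximalRealSubfield L)) = 1) ∧ ∃ ψ : ↥(Subgroup.center (Gqs L v)) →* ℂˣ, Continuous ψ ∧ σ = 𝔇.stG ψ) → 𝔇.innerG (𝔇.char σ) (𝔇.char σ) = 1 := by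
  intro σ
  induction σ using IrrClass.ind with
  | h r =>
  intro hL2σ _ _
  classical
  haveI : r.ρ.IsIrreducible := r.isIrreducible
  haveI : NonarchimedeanGroup (Gqs L v) :=
    nonarchimedeanGroup_unitaryGroupOfForm_local (E := L) (c := IsCMField.complexConj L) (N := 3) (v := v) (J' := (adelicForm L 3 (qsForm L)).map (adeleToLocal L v))
  haveI := compactSpace_integer_adicCompletion L w.1
  have hadm : r.ρ.IsAdmissible := F0P3cStCharTSScTracePackage.isAdmissible_smoothIrrep L v hns r
  have hϖ0 : ϖ ≠ 0 := CartanUnique.uniformizer_ne_zero hd.vϖ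
  have hϖ1 : Valued.v ϖ < 1 := by rw [hd.vϖ, ← WithZero.exp_zero]; exact WithZero.exp_lt_exp.2 (by norm_num)
  -- (E) a non-zero vector, its open stabiliser, the base vertex `A 0` with a frame `g₀`, and the level `e` (★ 43)
  haveI : Nontrivial r.V := Representation.IsIrreducible.nontrivial r.ρ
  obtain ⟨v₁, hv₁⟩ := exists_ne (0 : r.V)
  have hSo : IsOpen ((r.ρ.stabilizerSubgroup v₁ : Subgroup (Gqs L v)) : Set (Gqs L v)) := r.isSmooth v₁
  obtain ⟨A, hA0, hA1⟩ := exists_apartmentEnum (σ := (galAdicCompletionMap (L := L) (IsCMField.complexConj L) hw)) hd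
  obtain ⟨g₀, hg₀⟩ := exists_coe_eq_latt (galAdicCompletionMap (L := L) (IsCMField.complexConj L) hw) ϖ ((StdForm.antidiagonal 3).over (w.1.adicCompletion L)) (A 0)
  have hWo : IsOpen ((eA.symm : ↥(unitaryGroupOfForm (galAdicCompletionMap (L := L) (IsCMField.complexConj L) hw) ((StdForm.antidiagonal 3).over (w.1.adicCompletion L))) → Gqs L v) ⁻¹' ((r.ρ.stabilizerSubgroup v₁ : Subgroup (Gqs L v)) : Set (Gqs L v))) :=
    hSo.preimage eA.symm.continuous
  have hW1 : (1 : ↥(unitaryGroupOfForm (galAdicCompletionMap (L := L) (IsCMField.complexConj L) hw) ((StdForm.antidiagonal 3).over (w.1.adicCompletion L)))) ∈ (eA.symm : ↥(unitaryGroupOfForm (galAdicCompletionMap (L := L) (IsCMField.complexConj L) hw) ((StdForm.antidiagonal 3).over (w.1.adicCompletion L))) → Gqs L v) ⁻¹' ((r.ρ.stabilizerSubgroup v₁ : Subgroup (Gqs L v)) : Set (Gqs L v)) := by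
    show eA.symm 1 ∈ ((r.ρ.stabilizerSubgroup v₁ : Subgroup (Gqs L v)) : Set (Gqs L v))
    rw [map_one]
    exact (r.ρ.stabilizerSubgroup v₁).one_mem
  obtain ⟨e', he', h43⟩ := exists_forall_map_sub_one_latt_le_scaleLattice_pow_imp_mem_unitary (galAdicCompletionMap (L := L) (IsCMField.complexConj L) hw) ((StdForm.antidiagonal 3).over (w.1.adicCompletion L)) hϖ0 hϖ1 g₀ hWo hW1 1
  obtain ⟨e, rfl⟩ : ∃ e : ℕ, e' = e + 1 := ⟨e' - 1, by omega⟩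
  -- (T) the tree letters at level `e` (★ 41g-H §2)
  obtain ⟨a, U, ha, hU⟩ := F0P3cStCharTSCharacterEllipticUniform.exists_actionHom_unitaryLevelFamily L v w hw eA e
  have hUo : ∀ x, IsOpen (U x : Set (Gqs L v)) := fun x => F0P3cStCharTSCharacterEllipticUniform.isOpen_coe_unitaryLevel_gqs hU hd x
  have hUc : ∀ x, IsCompact (U x : Set (Gqs L v)) := fun x => F0P3cStCharTSCharacterEllipticUniform.isCompact_coe_unitaryLevel_gqs hU hd x
  have he : ∃ x₀ : {M : Submodule 𝒪[(w.1.adicCompletion L)] (Fin 3 → (w.1.adicCompletion L)) // IsVertex (galAdicCompletionMap (L := L) (IsCMField.complexConj L) hw) ϖ ((StdForm.antidiagonal 3).over (w.1.adicCompletion L)) M}, r.ρ.fixedPoints (U x₀) ≠ ⊥ := by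
    refine ⟨A 0, (Submodule.ne_bot_iff _).2 ⟨v₁, ?_, hv₁⟩⟩
    rw [Representation.mem_fixedPoints]
    intro g hg
    obtain ⟨-, hle⟩ := (hU (A 0) g).1 hg
    rw [hg₀] at hle
    have hmem : eA.symm (eA g) ∈ ((r.ρ.stabilizerSubgroup v₁ : Subgroup (Gqs L v)) : Set (Gqs L v)) := h43 (eA g) hle
    rw [eA.symm_apply_apply] at hmem
    exact hmem
  -- (O) orientation, edge groups, base edge, stabilisers
  obtain ⟨τ, hτ⟩ := exists_orientation_latticeGraph (galAdicCompletionMap (L := L) (IsCMField.complexConj L) hw) ϖ ((StdForm.antidiagonal 3).over (w.1.adicCompletion L))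
  have hfixE : ∀ (g : Gqs L v) (d : (latticeGraph (galAdicCompletionMap (L := L) (IsCMField.complexConj L) hw) ϖ ((StdForm.antidiagonal 3).over (w.1.adicCompletion L))).edgeSet), (a g).mapEdgeSet d = d ↔ a g (τ.head d) = τ.head d ∧ a g (τ.tail d) = τ.tail d := fun g d => by
    have h := head_mapEdgeSet_latticeGraphIso (galAdicCompletionMap (L := L) (IsCMField.complexConj L) hw) ϖ ((StdForm.antidiagonal 3).over (w.1.adicCompletion L)) hτ (eA g) d
    rw [← ha] at h
    exact iso_mapEdgeSet_eq_iff τ (a g) d h.1 h.2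
  have hEo : ∀ d : (latticeGraph (galAdicCompletionMap (L := L) (IsCMField.complexConj L) hw) ϖ ((StdForm.antidiagonal 3).over (w.1.adicCompletion L))).edgeSet, IsOpen ((U (τ.head d) ⊔ U (τ.tail d) : Subgroup (Gqs L v)) : Set (Gqs L v)) := fun d =>
    F0P3cStCharTSCharacterEllipticUniform.isOpen_coe_sup_unitaryLevel_gqs hU hd _ _
  have hEc : ∀ d : (latticeGraph (galAdicCompletionMap (L := L) (IsCMField.complexConj L) hw) ϖ ((StdForm.antidiagonal 3).over (w.1.adicCompletion L))).edgeSet, IsCompact ((U (τ.head d) ⊔ U (τ.tail d) : Subgroup (Gqs L v)) : Set (Gqs L v)) := fun d =>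
    F0P3cStCharTSCharacterEllipticUniform.isCompact_coe_sup_unitaryLevel_gqs_of_adj hU hd (τ.adj_head_tail d)
  have hadj : (latticeGraph (galAdicCompletionMap (L := L) (IsCMField.complexConj L) hw) ϖ ((StdForm.antidiagonal 3).over (w.1.adicCompletion L))).Adj (A 0) (A 1) := by
    simpa using latticeGraph_adj_apartmentEnum_succ hd A hA0 hA1 0
  obtain ⟨d₁, hd₁⟩ : ∃ d₁ : (latticeGraph (galAdicCompletionMap (L := L) (IsCMField.complexConj L) hw) ϖ ((StdForm.antidiagonal 3).over (w.1.adicCompletion L))).edgeSet, (d₁ : Sym2 {M : Submodule 𝒪[(w.1.adicCompletion L)] (Fin 3 → (w.1.adicCompletion L)) // IsVertex (galAdicCompletionMap (L := L) (IsCMField.complexConj L) hw) ϖ ((StdForm.antidiagonal 3).over (w.1.adicCompletion L)) M}) = s(A 0, A 1) := ⟨⟨s(A 0, A 1), (SimpleGraph.mem_edgeSet _).2 hadj⟩, rfl⟩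
  have hstab : ∀ x : {M : Submodule 𝒪[(w.1.adicCompletion L)] (Fin 3 → (w.1.adicCompletion L)) // IsVertex (galAdicCompletionMap (L := L) (IsCMField.complexConj L) hw) ϖ ((StdForm.antidiagonal 3).over (w.1.adicCompletion L)) M}, ∃ P : Subgroup (Gqs L v), ∀ g, g ∈ P ↔ a g x = x := fun x => by
    obtain ⟨Q, hQ⟩ := exists_stabilizerSubgroup (galAdicCompletionMap (L := L) (IsCMField.complexConj L) hw) ϖ ((StdForm.antidiagonal 3).over (w.1.adicCompletion L)) x
    exact ⟨Q.comap eA.toMonoidHom, fun g => by rw [F0P3cStCharTSCharacterEllipticUniform.mem_comap_iff', hQ, ha]⟩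
  obtain ⟨P₀, hP₀⟩ := hstab (τ.head d₁)
  obtain ⟨P₂, hP₂⟩ := hstab (τ.tail d₁)
  obtain ⟨P₁, hP₁⟩ : ∃ P₁ : Subgroup (Gqs L v), ∀ g, g ∈ P₁ ↔ (a g).mapEdgeSet d₁ = d₁ :=
    ⟨P₀ ⊓ P₂, fun g => by rw [Subgroup.mem_inf, hP₀, hP₂, hfixE]⟩
  -- stabilisers inside normalisers (★ (U3)), for the `K`-types
  have hPU₀ : P₀ ≤ Subgroup.normalizer ((U (τ.head d₁) : Subgroup (Gqs L v)) : Set (Gqs L v)) := fun g hg =>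
    F0P3cStCharTSCharacterEllipticUniform.mem_normalizer_unitaryLevel_gqs_of_apply_eq ha hU ((hP₀ g).1 hg)
  have hPU₂ : P₂ ≤ Subgroup.normalizer ((U (τ.tail d₁) : Subgroup (Gqs L v)) : Set (Gqs L v)) := fun g hg =>
    F0P3cStCharTSCharacterEllipticUniform.mem_normalizer_unitaryLevel_gqs_of_apply_eq ha hU ((hP₂ g).1 hg)
  have hPU₁ : P₁ ≤ Subgroup.normalizer ((U (τ.head d₁) ⊔ U (τ.tail d₁) : Subgroup (Gqs L v)) : Set (Gqs L v)) := fun g hg =>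
    Subgroup.normalizer_inf_normalizer_le_normalizer_sup (U (τ.head d₁)) (U (τ.tail d₁))
      (Subgroup.mem_inf.2 ⟨F0P3cStCharTSCharacterEllipticUniform.mem_normalizer_unitaryLevel_gqs_of_apply_eq ha hU ((hfixE g d₁).1 ((hP₁ g).1 hg)).1,
        F0P3cStCharTSCharacterEllipticUniform.mem_normalizer_unitaryLevel_gqs_of_apply_eq ha hU ((hfixE g d₁).1 ((hP₁ g).1 hg)).2⟩)
  -- finite-dimensional fixed spaces (admissibility), the three `K`-type restrictions (§0), the three pieces
  haveI : FiniteDimensional ℂ ↥(r.ρ.fixedPoints (U (τ.head d₁))) := hadm.finite_fixedPoints ⟨U (τ.head d₁), hUo _⟩ (hUc _)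
  haveI : FiniteDimensional ℂ ↥(r.ρ.fixedPoints (U (τ.tail d₁))) := hadm.finite_fixedPoints ⟨U (τ.tail d₁), hUo _⟩ (hUc _)
  haveI : FiniteDimensional ℂ ↥(r.ρ.fixedPoints (U (τ.head d₁) ⊔ U (τ.tail d₁))) := hadm.finite_fixedPoints ⟨U (τ.head d₁) ⊔ U (τ.tail d₁), hEo d₁⟩ (hEc d₁)
  obtain ⟨τ₀, hτρ₀, hτ₀⟩ := exists_restrictRep_fixedPoints r.ρ P₀ (U (τ.head d₁)) hPU₀
  obtain ⟨τ₂, hτρ₂, hτ₂⟩ := exists_restrictRep_fixedPoints r.ρ P₂ (U (τ.tail d₁)) hPU₂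
  obtain ⟨τ₁, hτρ₁, hτ₁⟩ := exists_restrictRep_fixedPoints r.ρ P₁ (U (τ.head d₁) ⊔ U (τ.tail d₁)) hPU₁
  obtain ⟨f₀, hfP₀, hf0₀⟩ : ∃ f₀ : Gqs L v → ℂ, (∀ (g : Gqs L v) (hg : g ∈ P₀), f₀ g = Representation.character τ₀ ⟨g, hg⟩⁻¹) ∧ ∀ g ∉ P₀, f₀ g = 0 :=
    ⟨fun g => if hg : g ∈ P₀ then Representation.character τ₀ ⟨g, hg⟩⁻¹ else 0, fun g hg => dif_pos hg, fun g hg => dif_neg hg⟩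
  obtain ⟨f₂, hfP₂, hf0₂⟩ : ∃ f₂ : Gqs L v → ℂ, (∀ (g : Gqs L v) (hg : g ∈ P₂), f₂ g = Representation.character τ₂ ⟨g, hg⟩⁻¹) ∧ ∀ g ∉ P₂, f₂ g = 0 :=
    ⟨fun g => if hg : g ∈ P₂ then Representation.character τ₂ ⟨g, hg⟩⁻¹ else 0, fun g hg => dif_pos hg, fun g hg => dif_neg hg⟩
  obtain ⟨f₁, hfP₁, hf0₁⟩ : ∃ f₁ : Gqs L v → ℂ, (∀ (g : Gqs L v) (hg : g ∈ P₁), f₁ g = Representation.character τ₁ ⟨g, hg⟩⁻¹) ∧ ∀ g ∉ P₁, f₁ g = 0 :=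
    ⟨fun g => if hg : g ∈ P₁ then Representation.character τ₁ ⟨g, hg⟩⁻¹ else 0, fun g hg => dif_pos hg, fun g hg => dif_neg hg⟩
  exact innerG_char_self_eq_one_of_unramified_explicit L v hns w hw hd eA heA νQv mQv hcanQ 𝔇 hμG horb hreg hE hM1 hWIF hC1 hC2 hC3 hL2 ha τ hτ hU hUo hUc hEo hEc hA0 hA1 d₁ hd₁
    P₀ P₂ P₁ hP₀ hP₂ hP₁ r he τ₀ hτρ₀ hτ₀ τ₂ hτρ₂ hτ₂ τ₁ hτρ₁ hτ₁ hfP₀ hf0₀ hfP₂ hf0₂ hfP₁ hf0₁ 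
    (F0P3cStCharTSHsplitOfL2.hsplit_of_isSquareIntegrable L v hns μZ r (hμGZ ▸ (hL2σ : IrrClass.IsSquareIntegrable 𝔇.μGZ (IrrClass.mk r))))

/-! ## §C ROW 72 «K2′-L²-UNR» IN THE JUNCTION'S LETTERS (§B over the ★ (G3) letters-from-`hunr` block, as S1∕S3 of ★ row 58): ZERO binders beyond the junction's letters -/

/-- **ROW 72 «K2′-L²-UNR», junction letters** (rider letter `hL2oneUnr := fun hunr => innerG_char_self_eq_one_of_isL2_of_unramified L v hns hunr νQv mQv hcanQ 𝔇 hC01 hC04 hC05 hE hchar μZ hC03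
hWIF hC1 hC2 hC3 hL2allcert`, LEAD T15-56 (4)): at a non-split place `v` UNRAMIFIED in `L`, text 2 of (S-𝔑) `hBlock′` holds at the §12.5 datum for every `L²` class — the (G3)-EXPLICIT letters exist because `v` is
unramified (★ `unramifiedLocalConjDatum_adicCompletion`) and `G_v ≃ₜ* U(antidiag(1,1,1))(L_w)` (★ `localNonsplitEquiv` re-read on `Φ₃`, pattern of ★ (G3) `exists_epFunction_G` :170–:196 ∕ row 58 S1).
[cite: Rogawski1990, §12.6 Prop. 12.6.1 (a) p. 188] [cite: SchneiderStuhler1997, §III.4] [cite: Kottwitz1988, §2] -/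
theorem innerG_char_self_eq_one_of_isL2_of_unramified
    (hns : ∀ w : PlacesOver L v, IsCMField.complexConj L • w.1 = w.1) (hunr : Algebra.IsUnramifiedIn (𝓞 L) v.asIdeal)
    [MeasurableSpace (Gqs L v)] [BorelSpace (Gqs L v)]
    [∀ γ : Gqs L v, MeasurableSpace (Gqs L v ⧸ Subgroup.centralizer ({γ} : Set (Gqs L v)))] [∀ γ : Gqs L v, BorelSpace (Gqs L v ⧸ Subgroup.centralizer ({γ} : Set (Gqs L v)))]
    [MeasurableSpace (Gqs L v ⧸ Subgroup.center (Gqs L v))]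
    {H : Type} [Group H] [TopologicalSpace H] [IsTopologicalGroup H] [MeasurableSpace H]
    (νQv : Measure (Gqs L v)) [νQv.IsHaarMeasure] [νQv.IsMulRightInvariant] (mQv : OrbitalMeasureFamily (Gqs L v))
    (hcanQ : mQv.IsCanonical (fun γ => IsRegularElt (γ.val : GL (Fin 3) (UnitaryGroup.LocalRing L v))) νQv)
    (𝔇 : EllipticData (Gqs L v) H) (hμG : 𝔇.μG = νQv) (horb : 𝔇.orb = mQv)
    (hreg : ∀ γ : Gqs L v, γ ∈ 𝔇.regG ↔ IsRegularElt (γ.val : GL (Fin 3) (UnitaryGroup.LocalRing L v)))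
    (hE : ∀ γ : Gqs L v, γ ∈ 𝔇.ellG ↔ IsRegularElt (γ.val : GL (Fin 3) (UnitaryGroup.LocalRing L v)) ∧ γ ∉ hyperbolicSet L v)
    (hM1 : ∀ π : IrrClass (Gqs L v), Measurable (𝔇.char π) ∧ LocallyIntegrable (𝔇.char π) 𝔇.μG ∧ (∀ x ∈ 𝔇.regG, ∀ᶠ y in 𝓝 x, 𝔇.char π y = 𝔇.char π x) ∧
      ∀ φ : Gqs L v → ℂ, IsLocSmooth φ → π.smoothTrace 𝔇.μG φ = ∫ x, φ x * 𝔇.char π x ∂𝔇.μG)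
    [BorelSpace (Gqs L v ⧸ Subgroup.center (Gqs L v))] (μZ : Measure (Gqs L v ⧸ Subgroup.center (Gqs L v))) [μZ.IsHaarMeasure] (hμGZ : 𝔇.μGZ = μZ)   -- the head's `μZ` (leaf :215–216) + junction `hC03`
    (hWIF : 𝔇.WeylIntegrationFormula) (hC1 : 𝔇.EllCartanSubset) (hC2 : 𝔇.EllCartanAE) (hC3 : 𝔇.NonEllCartanAE) (hL2 : 𝔇.L2CharOnTorusAll)   -- ★ PCT-OUT's extra letters
    :
    ∀ σ : IrrClass (Gqs L v), 𝔇.IsL2 σ → ¬ σ.IsSupercuspidal → ¬ ((Algebra.IsUnramifiedIn (𝓞 L) v.asIdeal ∨ Valued.v (2 : v.adicCompletion ↥(maximalRealSubfield L)) = 1) ∧ ∃ ψ : ↥(Subgroup.center (Gqs L v)) →* ℂˣ, Continuous ψ ∧ σ = 𝔇.stG ψ) → 𝔇.innerG (𝔇.char σ) (𝔇.char σ) = 1 := by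
  obtain ⟨w⟩ : Nonempty (PlacesOver L v) := inferInstance
  have hw : IsCMField.complexConj L • w.1 = w.1 := hns w
  have hc1 : IsCMField.complexConj L ≠ 1 := IsCMField.complexConj_ne_one L
  -- the unramified datum at `w` (this is where `hunr` is spent)
  obtain ⟨ϖ, hd⟩ := unramifiedLocalConjDatum_adicCompletion (IsCMField.complexConj L) hc1 v w hw hunr
  -- the one-place model re-read on the literal form `Φ₃ = antidiag(1,1,1)` (★ (G3) :189–:196)
  have hJw : placeForm (qsForm L) w.1 = (StdForm.antidiagonal 3).over (w.1.adicCompletion L) := by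
    rw [placeForm, qsForm, antidiagOne_eq_over, StdForm.over_map]
  obtain ⟨eA, heA⟩ : ∃ eA : Gqs L v ≃ₜ* ↥(unitaryGroupOfForm (galAdicCompletionMap (L := L) (IsCMField.complexConj L) hw) ((StdForm.antidiagonal 3).over (w.1.adicCompletion L))),
      ∀ g : Gqs L v, ((eA g : ↥(unitaryGroupOfForm (galAdicCompletionMap (L := L) (IsCMField.complexConj L) hw) ((StdForm.antidiagonal 3).over (w.1.adicCompletion L)))) :
          GL (Fin 3) (w.1.adicCompletion L)) =
        ((localNonsplitEquiv (IsCMField.complexConj L) (qsForm L) hc1 w hw g :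
          ↥(unitaryGroupOfForm (galAdicCompletionMap (L := L) (IsCMField.complexConj L) hw) (placeForm (qsForm L) w.1))) : GL (Fin 3) (w.1.adicCompletion L)) := by
    rw [← hJw]
    exact ⟨localNonsplitEquiv (IsCMField.complexConj L) (qsForm L) hc1 w hw, fun g => rfl⟩
  exact innerG_char_self_eq_one_of_isL2_of_unramified_explicit L v hns w hw hd eA heA νQv mQv hcanQ 𝔇 hμG horb hreg hE hM1 μZ hμGZ hWIF hC1 hC2 hC3 hL2

end Summit.HodgeConjecture.HodgeConjecture.Cruxes.H413.F0P3cStCharTSK2PrimeL2Unr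

end
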